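import Mathlib
import Summits.ValiantsHypothesis.ValiantsHypothesis.Theorems.RigidityForcesSymmetryRankRigidMinimalReprLaplaceFiveSeparatedCaptureCrossSix

/-!
# K1 on `K₃ ⊔ K₂` when six cross dimensions of short matrices sit at one letter

K1 consumer (local bridge ✓ `sideSym_K32canon_of_captureAt`) of ✓ `captureIneqSym_of_cross_ge_six` (`…SeparatedCaptureCrossSix`): a
side-symmetric split decomposition of `P₅` on the cuts `{01, 02, 12, 34}` whose three triangle short spans contain subspaces
`C₀₁, C₀₂, C₁₂` of matrices supported on the cross (row and column) of one letter `c`, of total finrank `≥ 6`, has Laplace weight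
`≥ 5! = 120` — the short spans being otherwise arbitrary.

Honest framing.  A sub-case of K1 on `K₃ ⊔ K₂`; K1 on `K₃ ⊔ K₂` in general, `CaptureIneqSym`, `LaplaceOptimalFive`
(OPEN · CONTESTED 72/120), `RankRigidMinimalRepr`, `VP ≠ VNP` are NOT proved.  No definitions, no `sorry`.
-/

set_option linter.dupNamespace false
set_option autoImplicit false

namespace Summit.ValiantsHypothesis.ValiantsHypothesis.Theorems.RigidityForcesSymmetryRankRigidMinimalRepr

namespace LaplaceFiveSeparatedCapture

open Finset LaplaceFiveSectorSplit

/-- ★★ **K1 ON `K₃ ⊔ K₂` WITH SIX CROSS DIMENSIONS OF SHORT MATRICES AT ONE LETTER.** [folklore] -/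
theorem sideSym_K32canon_cross_ge_six {N : ℕ} (T : Finset (Fin N)) (S : Fin N → Finset (Fin 5))
    (u w : Fin N → (Fin 5 → Fin 5) → ℂ) (hdec : IsSplitDecomposition T S u w) (hsym : SideSymmetric T S u w)
    (hC : ∀ t ∈ T, S t = ({0, 1} : Finset (Fin 5)) ∨ S t = ({0, 2} : Finset (Fin 5)) ∨
      S t = ({1, 2} : Finset (Fin 5)) ∨ S t = ({3, 4} : Finset (Fin 5)))
    (c d a b e : Fin 5) (hcov : ∀ x : Fin 5, x = c ∨ x = d ∨ x = a ∨ x = b ∨ x = e)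
    (C01 C02 C12 : Submodule ℂ (Fin 5 → Fin 5 → ℂ))
    (hC01 : C01 ≤ shortSpan T S u 0 1) (hC02 : C02 ≤ shortSpan T S u 0 2) (hC12 : C12 ≤ shortSpan T S u 1 2)
    (hx01 : ∀ x ∈ C01, ∀ p q : Fin 5, p ≠ c → q ≠ c → x p q = 0)
    (hx02 : ∀ x ∈ C02, ∀ p q : Fin 5, p ≠ c → q ≠ c → x p q = 0)
    (hx12 : ∀ x ∈ C12, ∀ p q : Fin 5, p ≠ c → q ≠ c → x p q = 0)
    (h6 : 6 ≤ Module.finrank ℂ C01 + Module.finrank ℂ C02 + Module.finrank ℂ C12) :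
    Nat.factorial 5 ≤ laplaceWeight T S :=
  sideSym_K32canon_of_captureAt T S u w hdec hsym hC fun hs01 hs02 hs12 W hWs hWd hWc =>
    captureIneqSym_of_cross_ge_six _ _ _ W C01 C02 C12 hs01 hs02 hs12 c d a b e hcov hC01 hC02 hC12 hx01 hx02 hx12 h6
      hWs hWd hWc

end LaplaceFiveSeparatedCapture

end Summit.ValiantsHypothesis.ValiantsHypothesis.Theorems.RigidityForcesSymmetryRankRigidMinimalRepr
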